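import Summits.BirchSwinnertonDyer.Rank1Residual.AdditivePotMult.LocalTowerKernelAtPPotMult
import Summits.BirchSwinnertonDyer.Rank1Residual.Iwasawa.LocalTowerKernelNumericTest
import HarnessLib

/-!
# `X(E/ℚ_∞) = 0` from `#Sel_{p^∞}(E/ℚ) = 1` for a curve ADDITIVE POTENTIALLY MULTIPLICATIVE at the
# odd prime `p` — the (M)-partner composition of T-T3CTL (Greenberg Prop. 3.8) with T-T3M's `v ∣ p`
# socket, every other bad place additive (`p ≥ 5`) or by the numeric test `p ∤ c_ℓ · #Ẽ_ns(𝔽_ℓ)`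
# (team n1011, row T-T3M, seat p12 GEN 9; file F5-M = the (M) twin of p06's
# `Iwasawa/SelmerInftyTrivialGoodOrdinary` and of `mu_anchor_of_card_selmer_eq_one_of_additive_away`)

HONEST FRAMING (cell `b2b-bsdres`, run/shared/lean/b2b/bsd-rank1-residual/, verbatim in every
file): the goal of the cell is to DELETE the COMBINATION-SHAPED residual classes of the
Birch–Swinnerton-Dyer formula for ALL analytic-rank `≤ 1` elliptic curves over `ℚ` — "full BSD
formula for every rank `≤ 1` curve in class `C`" assembled STRICTLY from published theorems — so
that the rank-`≤ 1` remainder becomes exactly the CONSTRUCTION-SHAPED classes, which are TYPED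
(missing-input `Prop`s), NOT attempted. This is not "finishing BSD". Team n1011 (N10/N11; row
T-T3M, skeleton `cells/n1011/skel/T-T3M.md`): research routes on CONSTRUCTION-SHAPED classes
(ROUTE 2 / Route G: the PARTNER side of the Greenberg–Vatsal / EPW transfers when the partner `E₁`
is (M) at `p`); prove what is provable now; no claim beyond stated classes; census output = EVIDENCE,
never a Literature fact; RESIDUAL-MAP marks UNCHANGED; nothing is booked by this file. Theorems
only; NO definition; NO new named fact; the ONLY named fact is the registered PUBLISHED A41
`Silverman1994_thmV53_corV54_tateUniformisation` (`hT41`). Closes no class by itself.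

## What

p06's T-T3CTL ENDs (`Iwasawa/SelmerInftyTrivialOfLevelZero`, `…LocalTowerKernelAdditive`,
`…LocalTowerKernelNumericTest`: Greenberg LNM 1716 Prop. 3.8 at level `0`) turn `#Sel_{p^∞}(E/ℚ) = 1`
into `X(E/ℚ_∞) = 0` modulo the local tower kernels at the finitely many bad places and at `v ∣ p`.
For a curve `E` that is ADDITIVE POTENTIALLY MULTIPLICATIVE at the odd prime `p` the `v ∣ p` socket
is ROW T-T3M's `PotMult.localTowerKerPrimary_zero_eq_bot` (F4-M; ANY `ℤ_p`-extension, no anomaly /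
Frobenius / `κ.IsCyclotomic` clause), the places `v ∤ p` are handled by F2b (additive, `p ≥ 5`) or
F2c (numeric test). Hence, for ANY `ℤ_p`-extension `κ` with topological generator `γ` and any dual
datum `D`:
* `PotMult.subsingleton_X_of_card_selmer_eq_one_of_additive_away (hT41) (hpm) (hp5) (D) (hγ) (hSel)
  (S) (hS) (hgood)` — `p ≥ 5`, each bad `v ∤ p` additive OR numeric;
* `PotMult.subsingleton_X_of_card_selmer_eq_one_numeric (hT41) (hpm) (hp2) …` — any odd `p`
  (`p = 3` included), each bad `v ∤ p` by the numeric test;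
* the unpacked invariants `…isTorsion_and_mu_eq_zero…` and the `μ`-anchor binder shapes
  `PotMult.mu_anchor_of_card_selmer_eq_one_of_additive_away / _numeric` (`∀ κ γ, κ.IsCyclotomic →
  κ.IsTopGenerator γ → IsCyclotomicVariable p γ → ∀ D₁, D₁.IsTorsion → D₁.mu = 0`, the `hμ₁`/`hmuA`
  binder of T-E346-TP §A / x9 U2 / the A-UP chain), from CENSUS NUMERICS ONLY on an (M)-at-`p`
  partner — the (M) twin of p06's good-ordinary non-anomalous file, WITHOUT the non-anomaly inputs.

References: [GreenbergLNM1716] R. Greenberg, LNM 1716 (1999), §3 Prop. 3.8 and Remark (pp. 95–96),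
Lemma 3.4 (p. 89); [Delbourgo1998] D. Delbourgo, Compositio Math. 113 (1998), §2.2 Lemma (p. 139),
Prop. 4 (p. 144); cells/n1011/skel/T-T3M.md; rows T-T3CTL / T-GR34NA (p06), T-T3B / T-T3M (p12).
-/

noncomputable section

open scoped Classical NumberField

namespace Summit.BirchSwinnertonDyer.Rank1Residual.AdditivePotMult

open NumberField IsDedekindDomain Field IsDedekindDomain.HeightOneSpectrum WeierstrassCurve
  Literature.NumberTheory.EllipticCurves Literature.NumberTheory.GaloisRepresentations
  Literature.NumberTheory.EllipticCurves.Rank1Residual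
  Summit.BirchSwinnertonDyer.Rank1Residual.Iwasawa Rat.HeightOneSpectrum

variable {W : WeierstrassCurve ℚ} [W.IsElliptic] [W.IsGloballyMinimal] {p : ℕ} [hp : Fact p.Prime]

/-- **`X(E/ℚ_∞) = 0` for an (M)-at-`p` curve with `#Sel_{p^∞}(E/ℚ) = 1`, `p ≥ 5`, additive or
numerically tested bad places away from `p`, ANY `ℤ_p`-extension** (mod A41): Greenberg's Prop. 3.8
(`subsingleton_X_of_card_selmer_eq_one_of_finset`) with the `v ∣ p` socket fed by T-T3M's
`PotMult.localTowerKerPrimary_zero_eq_bot`, the additive `v ∤ p` by F2b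
(`localTowerKerPrimary_zero_eq_bot_of_hasAdditiveReductionAt`) and the others by F2c
(`localTowerKerPrimary_zero_eq_bot_of_not_dvd`).
[cite: GreenbergLNM1716, §3 Prop. 3.8 and Remark (pp. 95–96)] -/
theorem PotMult.subsingleton_X_of_card_selmer_eq_one_of_additive_away
    (hT41 : Silverman1994_thmV53_corV54_tateUniformisation.{0}) (hpm : PotMult W p) (hp5 : 5 ≤ p)
    {κ : ZpExtension ℚ p} {γ : Field.absoluteGaloisGroup ℚ} (D : W.SelmerDualData κ γ)
    (hγ : κ.IsTopGenerator γ) (hSel : Nat.card (W.selmerGroupPInfty p) = 1)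
    (S : Finset (HeightOneSpectrum (𝓞 ℚ)))
    (hS : ∀ v ∈ S, (p : 𝓞 ℚ) ∉ v.asIdeal → W.HasAdditiveReductionAt v ∨
      ((primesEquiv v : ℕ) ≠ p ∧ ¬ p ∣ (W.baseChange (v.adicCompletion ℚ)).localTamagawaNumber
        (v.adicCompletionIntegers ℚ) * reductionPointCount W (primesEquiv v : ℕ)))
    (hgood : ∀ v ∉ S, (p : 𝓞 ℚ) ∉ v.asIdeal ∧ W.HasGoodReductionAt v) :
    Subsingleton D.X := by
  have hp2 : p ≠ 2 := by omega
  refine subsingleton_X_of_card_selmer_eq_one_of_finset D hγ hSel S (fun v hv ↦ ?_) hgood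
  by_cases hpv : (p : 𝓞 ℚ) ∈ v.asIdeal
  · exact hpm.localTowerKerPrimary_zero_eq_bot hT41 hp2 hpv κ
  · rcases hS v hv hpv with hadd | ⟨hne, hnum⟩
    · exact localTowerKerPrimary_zero_eq_bot_of_hasAdditiveReductionAt W v κ hpv hp5 hadd
    · haveI : Fact (Nat.Prime (primesEquiv v : ℕ)) := ⟨(primesEquiv v).2⟩
      exact localTowerKerPrimary_zero_eq_bot_of_not_dvd W κ v (primesEquiv v : ℕ) rfl hne hpv hnum

/-- **`X(E/ℚ_∞) = 0` for an (M)-at-`p` curve with `#Sel_{p^∞}(E/ℚ) = 1`, ANY odd `p` (`p = 3`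
included), every bad place `v ∤ p` by the numeric test `p ∤ c_ℓ · #Ẽ_ns(𝔽_ℓ)`, ANY `ℤ_p`-extension**
(mod A41) — the shape for `p = 3` partners. [cite: GreenbergLNM1716, §3 Prop. 3.8 and Remark (pp. 95–96)] -/
theorem PotMult.subsingleton_X_of_card_selmer_eq_one_numeric
    (hT41 : Silverman1994_thmV53_corV54_tateUniformisation.{0}) (hpm : PotMult W p) (hp2 : p ≠ 2)
    {κ : ZpExtension ℚ p} {γ : Field.absoluteGaloisGroup ℚ} (D : W.SelmerDualData κ γ)
    (hγ : κ.IsTopGenerator γ) (hSel : Nat.card (W.selmerGroupPInfty p) = 1)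
    (S : Finset (HeightOneSpectrum (𝓞 ℚ)))
    (hS : ∀ v ∈ S, (p : 𝓞 ℚ) ∉ v.asIdeal →
      (primesEquiv v : ℕ) ≠ p ∧ ¬ p ∣ (W.baseChange (v.adicCompletion ℚ)).localTamagawaNumber
        (v.adicCompletionIntegers ℚ) * reductionPointCount W (primesEquiv v : ℕ))
    (hgood : ∀ v ∉ S, (p : 𝓞 ℚ) ∉ v.asIdeal ∧ W.HasGoodReductionAt v) :
    Subsingleton D.X := by
  refine subsingleton_X_of_card_selmer_eq_one_of_finset D hγ hSel S (fun v hv ↦ ?_) hgood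
  by_cases hpv : (p : 𝓞 ℚ) ∈ v.asIdeal
  · exact hpm.localTowerKerPrimary_zero_eq_bot hT41 hp2 hpv κ
  · obtain ⟨hne, hnum⟩ := hS v hv hpv
    haveI : Fact (Nat.Prime (primesEquiv v : ℕ)) := ⟨(primesEquiv v).2⟩
    exact localTowerKerPrimary_zero_eq_bot_of_not_dvd W κ v (primesEquiv v : ℕ) rfl hne hpv hnum

/-- **`Λ`-torsion, `μ = 0`, `char = (g)` with `g` of unit content** for an (M)-at-`p` curve with
`#Sel_{p^∞}(E/ℚ) = 1` (`p ≥ 5`, additive or numerically tested bad places away from `p`), any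
`ℤ_p`-extension (mod A41). [cite: GreenbergLNM1716, §3 Prop. 3.8 and Remark (pp. 95–96)] -/
theorem PotMult.isTorsion_and_mu_eq_zero_of_card_selmer_eq_one_of_additive_away
    (hT41 : Silverman1994_thmV53_corV54_tateUniformisation.{0}) (hpm : PotMult W p) (hp5 : 5 ≤ p)
    {κ : ZpExtension ℚ p} {γ : Field.absoluteGaloisGroup ℚ} (D : W.SelmerDualData κ γ)
    (hγ : κ.IsTopGenerator γ) (hSel : Nat.card (W.selmerGroupPInfty p) = 1)
    (S : Finset (HeightOneSpectrum (𝓞 ℚ)))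
    (hS : ∀ v ∈ S, (p : 𝓞 ℚ) ∉ v.asIdeal → W.HasAdditiveReductionAt v ∨
      ((primesEquiv v : ℕ) ≠ p ∧ ¬ p ∣ (W.baseChange (v.adicCompletion ℚ)).localTamagawaNumber
        (v.adicCompletionIntegers ℚ) * reductionPointCount W (primesEquiv v : ℕ)))
    (hgood : ∀ v ∉ S, (p : 𝓞 ℚ) ∉ v.asIdeal ∧ W.HasGoodReductionAt v) :
    D.IsTorsion ∧ D.mu = 0 ∧
      ∃ g : PowerSeries ℤ_[p], D.charIdeal = Ideal.span {g} ∧ GreenbergVatsal2000.HasUnitContent g := by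
  haveI := hpm.subsingleton_X_of_card_selmer_eq_one_of_additive_away hT41 hp5 D hγ hSel S hS hgood
  exact ⟨isTorsion_of_subsingleton D, mu_eq_zero_of_subsingleton D,
    exists_charIdeal_eq_span_hasUnitContent_of_subsingleton D⟩

/-- **`Λ`-torsion, `μ = 0`, `char = (g)` with `g` of unit content** for an (M)-at-`p` curve with
`#Sel_{p^∞}(E/ℚ) = 1`, any odd `p`, every bad `v ∤ p` by the numeric test, any `ℤ_p`-extension
(mod A41). [cite: GreenbergLNM1716, §3 Prop. 3.8 and Remark (pp. 95–96)] -/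
theorem PotMult.isTorsion_and_mu_eq_zero_of_card_selmer_eq_one_numeric
    (hT41 : Silverman1994_thmV53_corV54_tateUniformisation.{0}) (hpm : PotMult W p) (hp2 : p ≠ 2)
    {κ : ZpExtension ℚ p} {γ : Field.absoluteGaloisGroup ℚ} (D : W.SelmerDualData κ γ)
    (hγ : κ.IsTopGenerator γ) (hSel : Nat.card (W.selmerGroupPInfty p) = 1)
    (S : Finset (HeightOneSpectrum (𝓞 ℚ)))
    (hS : ∀ v ∈ S, (p : 𝓞 ℚ) ∉ v.asIdeal →
      (primesEquiv v : ℕ) ≠ p ∧ ¬ p ∣ (W.baseChange (v.adicCompletion ℚ)).localTamagawaNumber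
        (v.adicCompletionIntegers ℚ) * reductionPointCount W (primesEquiv v : ℕ))
    (hgood : ∀ v ∉ S, (p : 𝓞 ℚ) ∉ v.asIdeal ∧ W.HasGoodReductionAt v) :
    D.IsTorsion ∧ D.mu = 0 ∧
      ∃ g : PowerSeries ℤ_[p], D.charIdeal = Ideal.span {g} ∧ GreenbergVatsal2000.HasUnitContent g := by
  haveI := hpm.subsingleton_X_of_card_selmer_eq_one_numeric hT41 hp2 D hγ hSel S hS hgood
  exact ⟨isTorsion_of_subsingleton D, mu_eq_zero_of_subsingleton D,
    exists_charIdeal_eq_span_hasUnitContent_of_subsingleton D⟩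

/-- **The `μ`-anchor binder (`hμ₁` of T-E346-TP §A, `hmuA` of x9's U2, the partner side of the GV
/ EPW transfer) for an (M)-at-`p` PARTNER from census numerics ONLY** (`p ≥ 5`, additive or
numerically tested bad places away from `p`; mod A41): for every cyclotomic `κ`, generator `γ`, dual
datum, `μ = 0` (indeed `X = 0`). No Delbourgo / non-anomaly / image input.
[cite: GreenbergLNM1716, §3 Prop. 3.8 and Remark (pp. 95–96)] -/
theorem PotMult.mu_anchor_of_card_selmer_eq_one_of_additive_away
    (hT41 : Silverman1994_thmV53_corV54_tateUniformisation.{0}) (hpm : PotMult W p) (hp5 : 5 ≤ p)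
    (hSel : Nat.card (W.selmerGroupPInfty p) = 1) (S : Finset (HeightOneSpectrum (𝓞 ℚ)))
    (hS : ∀ v ∈ S, (p : 𝓞 ℚ) ∉ v.asIdeal → W.HasAdditiveReductionAt v ∨
      ((primesEquiv v : ℕ) ≠ p ∧ ¬ p ∣ (W.baseChange (v.adicCompletion ℚ)).localTamagawaNumber
        (v.adicCompletionIntegers ℚ) * reductionPointCount W (primesEquiv v : ℕ)))
    (hgood : ∀ v ∉ S, (p : 𝓞 ℚ) ∉ v.asIdeal ∧ W.HasGoodReductionAt v) :
    ∀ (κ : ZpExtension ℚ p) (γ : Field.absoluteGaloisGroup ℚ),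
      κ.IsCyclotomic → κ.IsTopGenerator γ → IsCyclotomicVariable p γ →
      ∀ D₁ : W.SelmerDualData κ γ, D₁.IsTorsion → D₁.mu = 0 := by
  intro κ γ _ hγ _ D₁ _
  haveI := hpm.subsingleton_X_of_card_selmer_eq_one_of_additive_away hT41 hp5 D₁ hγ hSel S hS hgood
  exact mu_eq_zero_of_subsingleton D₁

/-- **The `μ`-anchor binder for an (M)-at-`p` PARTNER from census numerics ONLY, any odd `p`
(`p = 3` included), every bad `v ∤ p` by the numeric test** (mod A41).
[cite: GreenbergLNM1716, §3 Prop. 3.8 and Remark (pp. 95–96)] -/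
theorem PotMult.mu_anchor_of_card_selmer_eq_one_numeric
    (hT41 : Silverman1994_thmV53_corV54_tateUniformisation.{0}) (hpm : PotMult W p) (hp2 : p ≠ 2)
    (hSel : Nat.card (W.selmerGroupPInfty p) = 1) (S : Finset (HeightOneSpectrum (𝓞 ℚ)))
    (hS : ∀ v ∈ S, (p : 𝓞 ℚ) ∉ v.asIdeal →
      (primesEquiv v : ℕ) ≠ p ∧ ¬ p ∣ (W.baseChange (v.adicCompletion ℚ)).localTamagawaNumber
        (v.adicCompletionIntegers ℚ) * reductionPointCount W (primesEquiv v : ℕ))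
    (hgood : ∀ v ∉ S, (p : 𝓞 ℚ) ∉ v.asIdeal ∧ W.HasGoodReductionAt v) :
    ∀ (κ : ZpExtension ℚ p) (γ : Field.absoluteGaloisGroup ℚ),
      κ.IsCyclotomic → κ.IsTopGenerator γ → IsCyclotomicVariable p γ →
      ∀ D₁ : W.SelmerDualData κ γ, D₁.IsTorsion → D₁.mu = 0 := by
  intro κ γ _ hγ _ D₁ _
  haveI := hpm.subsingleton_X_of_card_selmer_eq_one_numeric hT41 hp2 D₁ hγ hSel S hS hgood
  exact mu_eq_zero_of_subsingleton D₁

end Summit.BirchSwinnertonDyer.Rank1Residual.AdditivePotMult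

end
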